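import Mathlib
import Literature.Computability.Complexity.CNF
import Literature.Computability.Complexity.PNPWave0
import Summits.PneNP.PneNP.Theses.OverlapGapAlgebra

/-!
# Exact self-couplings of the `F_k(n, m)` family and DETERMINISTIC monotonicity of the
# hardness conjunct of `SearchHardWindow` (crux stmt-PneNP-2460, crux-ideate round 2, ideator 6)

Two measure-preserving maps of the route's literal-array model `Φ : Fin m → Fin k → Fin n × Bool`
(all `m·k` literals i.i.d. uniform) along which satisfying assignments PULL BACK:

* variable quotient `quot : F_k(n'·q, m) → F_k(n', m)`, `v ↦ v / q` (merge variables in blocks of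
  `q`): exactly `q^{mk}`-to-one onto, and `x' ⊨ quot Φ ↔ lift x' ⊨ Φ` (block-constant lift);
* literal truncation `trunc : F_{k+1}(n, m) → F_k(n, m)` (drop the first literal of every clause):
  exactly `(2n)^m`-to-one onto, and `x ⊨ trunc Φ → x ⊨ Φ`.

Consequences (complexity-free core PROVED below; the word-level transcoding is an explicit
hypothesis = FP-brick plumbing for a prover):

* `successRatio_lift`  : a map `g'` on `F_k(n', m)` and its lift to `F_k(n'q, m)` have EQUAL
  success ratios — hence a deterministic poly-time solver at density `qα` yields one at density
  `α` with the same success, WITHOUT padding randomness or advice;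
* `successRatio_trunc` : `g ∘ trunc` on `F_{k+1}(n, m)` succeeds at least as often as `g` on
  `F_k(n, m)`.
* `hardAt_mul_of_hardAt`  : `QuotTranscoding q → HardAt k α → HardAt k (q * α)`   (q ≥ 1);
* `hardAt_of_hardAt_succ` : `TruncTranscoding → HardAt (k+1) α → HardAt k α`.

So the set `{(k, α) : HardAt k α}` is closed under `α ↦ qα (q ∈ ℕ⁺)` and `k ↦ k − 1`, in the
decl's own deterministic-uniform model. This corrects two statements on the record:
STRATEGY-CENSUS §Strengthen S3 ("hardness is upward-monotone in α [only] for advice-taking /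
randomised solvers"; "projecting a (k+1)-clause changes the law" — it does not, in the
with-replacement literal model) and TRIAGE-r1-1, freezing-edge (a) ("'weakest density' needs
padding with FRESH random clauses — not available to the deterministic IsPolyTime f").
It is a SUPPORT fact about the crux, not a line: no statement here is summit-strength.
-/

set_option linter.dupNamespace false

noncomputable section

namespace Summit.PneNP.PneNP.Cruxes.SearchHardWindow.ExactCouplings

open Finset Filter
open Literature.Computability.Complexity
open scoped Classical

/-- Instances of `F_k(n, m)` in the route's literal-array model. -/
abbrev Inst (m k n : ℕ) := Fin m → Fin k → Fin n × Bool

/-- `x` satisfies `Φ` (literal `(v, b)` true under `x` iff `x v = b`). -/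
abbrev Solves {m k n : ℕ} (x : Fin n → Bool) (Φ : Inst m k n) : Prop :=
  ∀ i, ∃ j, x (Φ i j).1 = (Φ i j).2

/-- The input word of an instance, verbatim as in the crux. -/
abbrev encInst {m k n : ℕ} (Φ : Inst m k n) : List Bool :=
  encodingCNF.encode (List.ofFn fun a => List.ofFn fun b => (((Φ a b).1 : ℕ), (Φ a b).2))

/-- The word function `f` solves `Φ` (its output read as the table `v ↦ (f x).getD v false`),
verbatim the success predicate of the crux. -/
abbrev WordSolves {m k n : ℕ} (f : List Bool → List Bool) (Φ : Inst m k n) : Prop :=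
  ∀ i, ∃ j, (f (encInst Φ)).getD (Φ i j).1 false = (Φ i j).2

/-- Success ratio of a word function on `F_k(n, m)`. -/
def successRatio (f : List Bool → List Bool) (k n m : ℕ) : ℝ :=
  ((univ.filter fun Φ : Inst m k n => WordSolves f Φ).card : ℝ) / Fintype.card (Inst m k n)

/-- The hardness conjunct of `SearchHardWindow` at `(k, α)`. -/
def HardAt (k : ℕ) (α : ℝ) : Prop :=
  ∀ f : List Bool → List Bool, IsPolyTime f → ∀ ε : ℝ, 0 < ε →
    ∀ᶠ n : ℕ in atTop, ∀ m : ℕ, m = ⌊α * n⌋₊ → successRatio f k n m ≤ ε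

/-- `HardAt` is verbatim the second conjunct of the crux (definitional unfolding). -/
theorem hardAt_iff (k : ℕ) (α : ℝ) : HardAt k α ↔
    ∀ f : List Bool → List Bool, IsPolyTime f → ∀ ε : ℝ, 0 < ε →
      ∀ᶠ n : ℕ in atTop, ∀ m : ℕ, m = ⌊α * n⌋₊ →
        ((Finset.univ.filter fun Φ : Fin m → Fin k → Fin n × Bool => ∀ i, ∃ j,
          (f (encodingCNF.encode (List.ofFn fun a => List.ofFn fun b =>
            (((Φ a b).1 : ℕ), (Φ a b).2)))).getD (Φ i j).1 false = (Φ i j).2).card : ℝ) /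
          Fintype.card (Fin m → Fin k → Fin n × Bool) ≤ ε := by
  simp only [HardAt, successRatio, WordSolves, encInst]

/-- The crux is `∃ k α, PosSat ∧ HardAt k α` (sanity link to the route decl). -/
theorem searchHardWindow_iff :
    Summit.PneNP.PneNP.Theses.OverlapGapAlgebra.SearchHardWindow ↔
      ∃ (k : ℕ) (α : ℝ), (∃ ε : ℝ, 0 < ε ∧ ∀ᶠ n : ℕ in atTop, ∀ m : ℕ, m = ⌊α * n⌋₊ →
        ε ≤ ((Finset.univ.filter fun Φ : Fin m → Fin k → Fin n × Bool =>
          ∃ σ : Fin n → Bool, ∀ i, ∃ j, σ (Φ i j).1 = (Φ i j).2).card : ℝ) /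
            Fintype.card (Fin m → Fin k → Fin n × Bool)) ∧ HardAt k α := by
  simp only [Summit.PneNP.PneNP.Theses.OverlapGapAlgebra.SearchHardWindow, HardAt, successRatio,
    WordSolves, encInst]

/-! ## Coupling 1: the variable quotient (density `× q`) -/

/-- Merge variables in blocks of `q`: `v ↦ v / q`. -/
def quotVar {n' q : ℕ} (v : Fin (n' * q)) : Fin n' := (finProdFinEquiv.symm v).1

theorem coe_quotVar {n' q : ℕ} (v : Fin (n' * q)) : (quotVar v : ℕ) = (v : ℕ) / q := by
  simp [quotVar, finProdFinEquiv_symm_apply, Fin.coe_divNat]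

/-- The quotient instance on `n'` variables. -/
def quot {m k n' q : ℕ} (Φ : Inst m k (n' * q)) : Inst m k n' :=
  fun i j => (quotVar (Φ i j).1, (Φ i j).2)

/-- Block-constant lift of an assignment of the quotient variables. -/
def liftAssign {n' : ℕ} (q : ℕ) (x' : Fin n' → Bool) : Fin (n' * q) → Bool :=
  fun v => x' (quotVar v)

theorem liftAssign_solves_iff {m k n' q : ℕ} (x' : Fin n' → Bool) (Φ : Inst m k (n' * q)) :
    Solves (liftAssign q x') Φ ↔ Solves x' (quot Φ) :=
  Iff.rfl

/-- The coupling: an instance on `n'·q` variables IS (its quotient, its block offsets). -/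
def quotEquiv (m k n' q : ℕ) : Inst m k (n' * q) ≃ Inst m k n' × (Fin m → Fin k → Fin q) where
  toFun Φ := (quot Φ, fun i j => (finProdFinEquiv.symm (Φ i j).1).2)
  invFun p := fun i j => (finProdFinEquiv ((p.1 i j).1, p.2 i j), (p.1 i j).2)
  left_inv Φ := by
    funext i j
    show (finProdFinEquiv ((finProdFinEquiv.symm (Φ i j).1).1, (finProdFinEquiv.symm (Φ i j).1).2),
      (Φ i j).2) = Φ i j
    rw [Prod.mk.eta, Equiv.apply_symm_apply]
  right_inv p := by
    obtain ⟨Φ', ρ⟩ := p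
    refine Prod.ext ?_ ?_
    · funext i j
      show (quotVar (finProdFinEquiv ((Φ' i j).1, ρ i j)), (Φ' i j).2) = Φ' i j
      rw [quotVar, Equiv.symm_apply_apply]
    · funext i j
      show (finProdFinEquiv.symm (finProdFinEquiv ((Φ' i j).1, ρ i j))).2 = ρ i j
      rw [Equiv.symm_apply_apply]

theorem quotEquiv_fst {m k n' q : ℕ} (Φ : Inst m k (n' * q)) : (quotEquiv m k n' q Φ).1 = quot Φ :=
  rfl

/-- Counting along a first projection. -/
theorem card_filter_fst {α β : Type*} [Fintype α] [Fintype β] (P : α → Prop) [DecidablePred P] :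
    ((univ : Finset (α × β)).filter fun p => P p.1).card = (univ.filter P).card * Fintype.card β := by
  have h : ((univ : Finset (α × β)).filter fun p => P p.1) = (univ.filter P) ×ˢ (univ : Finset β) := by
    ext ⟨a, b⟩
    simp only [Finset.mem_filter, Finset.mem_univ, true_and, Finset.mem_product, and_true]
  rw [h, Finset.card_product, Finset.card_univ]

/-- Exact `q^{mk}`-to-one: pre-images of a predicate under `quot`. -/
theorem card_filter_quot {m k n' q : ℕ} (P : Inst m k n' → Prop) [DecidablePred P] :
    ((univ : Finset (Inst m k (n' * q))).filter fun Φ => P (quot Φ)).card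
      = (univ.filter P).card * Fintype.card (Fin m → Fin k → Fin q) := by
  have h1 : ((univ : Finset (Inst m k (n' * q))).filter fun Φ => P (quot Φ)).card
      = ((univ : Finset (Inst m k n' × (Fin m → Fin k → Fin q))).filter fun p => P p.1).card := by
    refine Finset.card_equiv (quotEquiv m k n' q) ?_
    intro Φ
    simp only [Finset.mem_filter, Finset.mem_univ, true_and]
    exact Iff.rfl
  rw [h1, card_filter_fst]

theorem card_inst_quot (m k n' q : ℕ) :
    Fintype.card (Inst m k (n' * q)) = Fintype.card (Inst m k n') * Fintype.card (Fin m → Fin k → Fin q) := by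
  rw [Fintype.card_congr (quotEquiv m k n' q), Fintype.card_prod]

/-- **Transport of success along the quotient (complexity-free core).** For ANY map `g'` on
`F_k(n', m)`, the lifted map `Φ ↦ lift (g' (quot Φ))` on `F_k(n'·q, m)` has exactly the same
success ratio. -/
theorem successRatio_lift {m k n' q : ℕ} (hq : 0 < q) (g' : Inst m k n' → (Fin n' → Bool)) :
    (((univ : Finset (Inst m k (n' * q))).filter fun Φ => Solves (liftAssign q (g' (quot Φ))) Φ).card : ℝ)
        / Fintype.card (Inst m k (n' * q))
      = ((univ.filter fun Φ' : Inst m k n' => Solves (g' Φ') Φ').card : ℝ) / Fintype.card (Inst m k n') := by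
  have hset : ((univ : Finset (Inst m k (n' * q))).filter fun Φ => Solves (liftAssign q (g' (quot Φ))) Φ)
      = univ.filter fun Φ => (fun Φ' => Solves (g' Φ') Φ') (quot Φ) := rfl
  have hc : (0 : ℝ) < Fintype.card (Fin m → Fin k → Fin q) := by
    have : Nonempty (Fin m → Fin k → Fin q) := ⟨fun _ _ => ⟨0, hq⟩⟩
    exact_mod_cast Fintype.card_pos
  rw [hset, card_filter_quot (fun Φ' => Solves (g' Φ') Φ'), card_inst_quot]
  push_cast
  rw [mul_div_mul_right _ _ hc.ne']

/-! ## Coupling 2: literal truncation (`k + 1 ↦ k`) -/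

/-- Drop the first literal of every clause. -/
def trunc {m k n : ℕ} (Φ : Inst m (k + 1) n) : Inst m k n := fun i => Fin.tail (Φ i)

theorem solves_of_solves_trunc {m k n : ℕ} (x : Fin n → Bool) (Φ : Inst m (k + 1) n) :
    Solves x (trunc Φ) → Solves x Φ :=
  fun h i => let ⟨j, hj⟩ := h i; ⟨j.succ, hj⟩

def truncEquiv (m k n : ℕ) : Inst m (k + 1) n ≃ Inst m k n × (Fin m → Fin n × Bool) where
  toFun Φ := (trunc Φ, fun i => Φ i 0)
  invFun p := fun i => Fin.cons (p.2 i) (p.1 i)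
  left_inv Φ := by
    funext i
    show Fin.cons (Φ i 0) (Fin.tail (Φ i)) = Φ i
    rw [Fin.cons_self_tail]
  right_inv p := by
    obtain ⟨Φ', h⟩ := p
    refine Prod.ext ?_ ?_
    · funext i
      show Fin.tail (Fin.cons (h i) (Φ' i) : Fin (k + 1) → Fin n × Bool) = Φ' i
      rw [Fin.tail_cons]
    · funext i
      show (Fin.cons (h i) (Φ' i) : Fin (k + 1) → Fin n × Bool) 0 = h i
      rw [Fin.cons_zero]

theorem card_filter_trunc {m k n : ℕ} (P : Inst m k n → Prop) [DecidablePred P] :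
    ((univ : Finset (Inst m (k + 1) n)).filter fun Φ => P (trunc Φ)).card
      = (univ.filter P).card * Fintype.card (Fin m → Fin n × Bool) := by
  have h1 : ((univ : Finset (Inst m (k + 1) n)).filter fun Φ => P (trunc Φ)).card
      = ((univ : Finset (Inst m k n × (Fin m → Fin n × Bool))).filter fun p => P p.1).card := by
    refine Finset.card_equiv (truncEquiv m k n) ?_
    intro Φ
    simp only [Finset.mem_filter, Finset.mem_univ, true_and]
    exact Iff.rfl
  rw [h1, card_filter_fst]

theorem card_inst_trunc (m k n : ℕ) :
    Fintype.card (Inst m (k + 1) n) = Fintype.card (Inst m k n) * Fintype.card (Fin m → Fin n × Bool) := by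
  rw [Fintype.card_congr (truncEquiv m k n), Fintype.card_prod]

/-- **Transport of success along truncation (complexity-free core).** For ANY map `g` on
`F_k(n, m)`, `g ∘ trunc` on `F_{k+1}(n, m)` succeeds at least as often (`n ≥ 1`). -/
theorem successRatio_trunc {m k n : ℕ} (hn : 0 < n) (g : Inst m k n → (Fin n → Bool)) :
    ((univ.filter fun Φ' : Inst m k n => Solves (g Φ') Φ').card : ℝ) / Fintype.card (Inst m k n)
      ≤ (((univ : Finset (Inst m (k + 1) n)).filter fun Φ => Solves (g (trunc Φ)) Φ).card : ℝ)
          / Fintype.card (Inst m (k + 1) n) := by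
  have hsub : ((univ : Finset (Inst m (k + 1) n)).filter fun Φ => (fun Φ' => Solves (g Φ') Φ') (trunc Φ))
      ⊆ univ.filter fun Φ => Solves (g (trunc Φ)) Φ := by
    intro Φ hΦ
    simp only [Finset.mem_filter, Finset.mem_univ, true_and] at hΦ ⊢
    exact solves_of_solves_trunc _ _ hΦ
  have hc : (0 : ℝ) < Fintype.card (Fin m → Fin n × Bool) := by
    have : Nonempty (Fin m → Fin n × Bool) := ⟨fun _ => (⟨0, hn⟩, true)⟩
    exact_mod_cast Fintype.card_pos
  have hle := Finset.card_le_card hsub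
  rw [card_filter_trunc (fun Φ' => Solves (g Φ') Φ')] at hle
  rw [card_inst_trunc]
  push_cast
  calc ((univ.filter fun Φ' : Inst m k n => Solves (g Φ') Φ').card : ℝ) / Fintype.card (Inst m k n)
      = ((univ.filter fun Φ' : Inst m k n => Solves (g Φ') Φ').card : ℝ) * Fintype.card (Fin m → Fin n × Bool)
          / (Fintype.card (Inst m k n) * Fintype.card (Fin m → Fin n × Bool)) := by
        rw [mul_div_mul_right _ _ hc.ne']
    _ ≤ _ := by
        gcongr
        exact_mod_cast hle

/-! ## The crux-level transport, modulo word-level transcoding (FP bricks, prover work)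

`QuotTranscoding q`: for every poly-time `f'` there is a poly-time `f` whose answer table on the
word of `Φ` is the block-constant stretch of `f'`'s table on the word of `quot Φ`
(`f = stretch_q ∘ f' ∘ requot_q`: parse the CNF word, map every variable index `v ↦ v / q`,
re-encode; afterwards stretch the output table `y' ↦ (v ↦ y'[v / q])`). `TruncTranscoding`:
`f = f' ∘ retrunc` (drop the first literal of each clause of the CNF word). Both are closure
properties of `IsPolyTime` under composition with linear-time list transcoders — routine in the
tree's TM2/FP brick library (cf. NegCNFTranscoder.lean), deliberately NOT done in this sketch. -/

/-- Poly-time closure under the quotient transcoding (word level). -/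
def QuotTranscoding (q : ℕ) : Prop :=
  ∀ f' : List Bool → List Bool, IsPolyTime f' → ∃ f : List Bool → List Bool, IsPolyTime f ∧
    ∀ (m k n' : ℕ) (Φ : Inst m k (n' * q)) (v : Fin (n' * q)),
      (f (encInst Φ)).getD v false = (f' (encInst (quot Φ))).getD (quotVar v) false

/-- Poly-time closure under the truncation transcoding (word level). -/
def TruncTranscoding : Prop :=
  ∀ f' : List Bool → List Bool, IsPolyTime f' → ∃ f : List Bool → List Bool, IsPolyTime f ∧
    ∀ (m k n : ℕ) (Φ : Inst m (k + 1) n), f (encInst Φ) = f' (encInst (trunc Φ))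

/-- **Deterministic upward monotonicity in the density.** `HardAt k α → HardAt k (q α)` for every
integer `q ≥ 1`, in the crux's own model (uniform deterministic poly-time word functions, no
advice, no coins), modulo the transcoding plumbing. -/
theorem hardAt_mul_of_hardAt {k q : ℕ} (hq : 0 < q) {α : ℝ} (hT : QuotTranscoding q)
    (hH : HardAt k α) : HardAt k (q * α) := by
  intro f' hf' ε hε
  obtain ⟨f, hf, hspec⟩ := hT f' hf'
  have hev := hH f hf ε hε
  obtain ⟨N, hN⟩ := eventually_atTop.1 hev
  refine eventually_atTop.2 ⟨N, fun n' hn' m hm => ?_⟩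
  have hn : N ≤ n' * q := le_trans hn' (Nat.le_mul_of_pos_right _ hq)
  have hm' : m = ⌊α * ((n' * q : ℕ) : ℝ)⌋₊ := by
    rw [hm]; congr 1; push_cast; ring
  have key := hN (n' * q) hn m hm'
  -- the success event of `f` on `Φ` is the success event of `f'` on `quot Φ`
  have hset : ((univ : Finset (Inst m k (n' * q))).filter fun Φ => WordSolves f Φ)
      = univ.filter fun Φ => (fun Φ' : Inst m k n' => WordSolves f' Φ') (quot Φ) := by
    ext Φ
    simp only [Finset.mem_filter, Finset.mem_univ, true_and, WordSolves, hspec]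
    exact Iff.rfl
  have hc : (0 : ℝ) < Fintype.card (Fin m → Fin k → Fin q) := by
    have : Nonempty (Fin m → Fin k → Fin q) := ⟨fun _ _ => ⟨0, hq⟩⟩
    exact_mod_cast Fintype.card_pos
  unfold successRatio at key ⊢
  rw [hset, card_filter_quot (fun Φ' : Inst m k n' => WordSolves f' Φ'), card_inst_quot] at key
  push_cast at key
  rwa [mul_div_mul_right _ _ hc.ne'] at key

/-- **Downward monotonicity in the clause width.** `HardAt (k+1) α → HardAt k α`
(a solver for width `k` solves width `k+1` by ignoring one literal per clause), modulo plumbing. -/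
theorem hardAt_of_hardAt_succ {k : ℕ} {α : ℝ} (hT : TruncTranscoding)
    (hH : HardAt (k + 1) α) : HardAt k α := by
  intro f' hf' ε hε
  obtain ⟨f, hf, hspec⟩ := hT f' hf'
  have hev := hH f hf ε hε
  filter_upwards [hev, eventually_ge_atTop 1] with n hn hn1 m hm
  have key := hn m hm
  -- `f'` solves `trunc Φ` ⟹ `f` solves `Φ`
  have hsub : ((univ : Finset (Inst m (k + 1) n)).filter fun Φ => (fun Φ' : Inst m k n => WordSolves f' Φ') (trunc Φ))
      ⊆ univ.filter fun Φ => WordSolves f Φ := by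
    intro Φ hΦ
    simp only [Finset.mem_filter, Finset.mem_univ, true_and, WordSolves] at hΦ ⊢
    intro i
    obtain ⟨j, hj⟩ := hΦ i
    exact ⟨j.succ, by rw [hspec]; exact hj⟩
  have hc : (0 : ℝ) < Fintype.card (Fin m → Fin n × Bool) := by
    have : Nonempty (Fin m → Fin n × Bool) := ⟨fun _ => (⟨0, hn1⟩, true)⟩
    exact_mod_cast Fintype.card_pos
  have hle := Finset.card_le_card hsub
  rw [card_filter_trunc (fun Φ' : Inst m k n => WordSolves f' Φ')] at hle
  unfold successRatio at key ⊢
  rw [card_inst_trunc] at key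
  push_cast at key
  calc ((univ.filter fun Φ' : Inst m k n => WordSolves f' Φ').card : ℝ) / Fintype.card (Inst m k n)
      = ((univ.filter fun Φ' : Inst m k n => WordSolves f' Φ').card : ℝ) * Fintype.card (Fin m → Fin n × Bool)
          / (Fintype.card (Inst m k n) * Fintype.card (Fin m → Fin n × Bool)) := by
        rw [mul_div_mul_right _ _ hc.ne']
    _ ≤ ((univ.filter fun Φ : Inst m (k + 1) n => WordSolves f Φ).card : ℝ)
          / (Fintype.card (Inst m k n) * Fintype.card (Fin m → Fin n × Bool)) := by
        gcongr
        exact_mod_cast hle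
    _ ≤ ε := key

/-- Iterating: hardness flows from `(k, α)` to every `(k - j, q α)`, `q ≥ 1`. In particular the
crux `∃ k α, PosSat k α ∧ HardAt k α` may take its witness density anywhere in `α_k · ℕ⁺ ∩ (0, ρ_k)`
once `HardAt k α_k` is known — the "weakest instance" bookkeeping of the freezing-edge card holds
in the deterministic model too. -/
theorem hardAt_flow {k j q : ℕ} (hq : 0 < q) {α : ℝ} (hQ : QuotTranscoding q)
    (hTr : TruncTranscoding) (hH : HardAt (k + j) α) : HardAt k (q * α) := by
  induction j with
  | zero => exact hardAt_mul_of_hardAt hq hQ hH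
  | succ j ih => exact ih (hardAt_of_hardAt_succ hTr hH)

end Summit.PneNP.PneNP.Cruxes.SearchHardWindow.ExactCouplings

end
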